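import Summits.AnomalousDissipation.AnomalousDissipation.Theorems.SawtoothPulseCascadeK1LocalisedCascadeRatioClassStepV
import Summits.AnomalousDissipation.AnomalousDissipation.Theorems.SawtoothPulseCascadeK1LocalisedCascadeClassStepVLog
import Mathlib.Analysis.SpecialFunctions.Log.Basic

/-!
# K1loc, line `Spectral` / thin start — helper: RATIO CLASSES THROUGH A V HALF-STEP WITH THE SHARP KERNEL CONSTANTS

Helper file of the prover lane on the crux `K1LocalisedCascade` (stmt-AnomalousDissipation-19491), route
`SawtoothPulseCascade` (S-D fibre ledger; memo v12 §14 lever (1)).  `…RatioClassStepV.tsum_ratioClass_vstep_le` with the sharp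
kernel constants of `…TrapezoidLog` / `…TrapezoidTail` (p3 g3) in place of the ratio bounds: with `D* = (uG−v)Λ − uQ₂` and
`R* = ((v+uG)Λ + uQ₂)/D*` (the lowest fibre of the block),
`A = 4/π + (2/π)·log R* + u/D* + u²/(π D*²)`, `τ = u/(2D*)`:
**`tsum_ratioClass_vstep_le_log`** — same conclusion as the ratio version.  The per-fibre log expressions are dominated by the
lowest fibre because `(p(n)+|n|G)/(|n|G−p(n)) ≤ R*` (`ratioClass_ratio_le`) and `|n|G − p(n) ≥ D*/u`.
No definitions; no statement about the crux. [cite: Grafakos2014, Prop. 3.1.2 (5), Prop. 3.2.7 (3), §3.1.3]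
[cite: ElgindiLissMattingly2025, §1 (slope ±1 branches)] [problem: turb]
-/

-- `Summit.<Summit>.<Problem>`: single-conjunct summit, the duplicate namespace segment is deliberate.
set_option linter.dupNamespace false

noncomputable section

namespace Summit.AnomalousDissipation.AnomalousDissipation.Theorems.SawtoothPulseCascade.K1Window

open MeasureTheory Set Filter Topology UnitAddTorus Function Complex Metric
open scoped Real ENNReal
open Literature.Analysis Literature.Analysis.FunctionSpaces Literature.Analysis.FunctionSpaces.Torus Literature.Analysis.FluidPDE
open Literature.Analysis.FluidPDE.ShearStage
open Literature.Analysis.FluidPDE.SawtoothCascade Literature.Analysis.FluidPDE.SawtoothCascade.CascadeParams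
open Summit.AnomalousDissipation.AnomalousDissipation.Theorems.SawtoothPulseCascade.K1Start
open Summit.AnomalousDissipation.AnomalousDissipation.Theorems.SawtoothPulseCascade.K1Flat
open Summit.AnomalousDissipation.AnomalousDissipation.Theorems.SawtoothPulseCascade.K1Ledger.From

section Cascade

variable (P : CascadeParams)

/-- **LEDGER STEP for a ratio class through the V half-step, one block, sharp kernel constants** (see the file header).
[cite: Grafakos2014, Prop. 3.1.2 (5), Prop. 3.2.7 (3), §3.1.3] -/
theorem tsum_ratioClass_vstep_le_log {G : ℕ} (hγ : P.γ = G) (hδ₀ : 0 < P.δ₀) (hd : 0 < P.d) (hN₀ : 1 ≤ P.N₀) (hρN : 1 ≤ P.ρN)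
    (a b : ℕ → UnitAddTorus (Fin 2) → ℝ) (has : ∀ j, IsSmooth (a j)) (h0 : a 0 = datum)
    (hb : ∀ j, b j = a j ∘ shearMap 0 1 (amp ⟨P.U j, P.U_periodic j, P.contDiff_U (P.δ_pos hδ₀ hd j)⟩ P.γ))
    (hab : ∀ j, a (j + 1) = b j ∘ shearMap 1 0 (amp ⟨P.U j, P.U_periodic j, P.contDiff_U (P.δ_pos hδ₀ hd j)⟩ P.γ))
    (j : ℕ) {u v X Q₁ Q₂ Λ Λ' : ℕ} (hu : 0 < u) (hv : 0 < v) (hQ : Q₁ < Q₂) (hvu : v < u * G)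
    (hΛQ : u * Q₂ < Λ * (u * G - v)) (hΛX : v * Λ ≤ u * X) (hΛ0 : 0 < Λ) (hΛΛ' : Λ ≤ Λ')
    {d₀ M ε₀ : ℝ} (hd₀ : 0 < d₀) (hM : 1 ≤ M) (hMδ : M * P.δ j < π / 2) (hMd : M * P.δ j < π * P.N j * d₀)
    (hAd : 8 * ((u : ℝ) / (2 * (((u : ℝ) * G - v) * Λ - u * Q₂))) ≤
      (4 / π + 2 / π * Real.log ((((v : ℝ) + u * G) * Λ + u * Q₂) / (((u : ℝ) * G - v) * Λ - u * Q₂)) +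
        (u : ℝ) / (((u : ℝ) * G - v) * Λ - u * Q₂) + (u : ℝ) ^ 2 / (π * (((u : ℝ) * G - v) * Λ - u * Q₂) ^ 2)) * d₀)
    (hε0 : 0 ≤ ε₀)
    (hε : (4 / π + 2 / π * Real.log ((((v : ℝ) + u * G) * Λ + u * Q₂) / (((u : ℝ) * G - v) * Λ - u * Q₂)) +
        (u : ℝ) / (((u : ℝ) * G - v) * Λ - u * Q₂) + (u : ℝ) ^ 2 / (π * (((u : ℝ) * G - v) * Λ - u * Q₂) ^ 2)) *
      (2 * π * ((Λ' * G : ℕ) : ℝ) * (Real.exp (-(M ^ 2 / 2)) / (2 * P.N j))) ≤ ε₀) :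
    ∑' k : Fin 2 → ℤ, (if (X : ℤ) ≤ |k 0| ∧ (u : ℤ) * |k 0| ≤ v * |k 1| then (1 : ℝ) else 0) *
        ‖mFourierCoeff (fun x => (a (j + 1) x : ℂ)) k‖ ^ 2 ≤
      ((((Q₁ : ℝ) + Q₂) / ((Q₂ : ℝ) - Q₁)) *
            (ε₀ + (4 / π + 2 / π * Real.log ((((v : ℝ) + u * G) * Λ + u * Q₂) / (((u : ℝ) * G - v) * Λ - u * Q₂)) +
        (u : ℝ) / (((u : ℝ) * G - v) * Λ - u * Q₂) + (u : ℝ) ^ 2 / (π * (((u : ℝ) * G - v) * Λ - u * Q₂) ^ 2)) *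
              Real.sqrt ((2 * P.N j : ℕ) * (4 * d₀))) +
          Real.sqrt (∑' k : Fin 2 → ℤ, (if (Λ : ℤ) ≤ |k 1| ∧ |k 1| ≤ Λ' ∧ (Q₁ : ℤ) < |k 0| then (1 : ℝ) else 0) *
            ‖mFourierCoeff (fun x => (b j x : ℂ)) k‖ ^ 2)) ^ 2 +
        ((1 + P.γ) ^ (2 * (j + 1)) / Λ') ^ 2 := by
  classical
  -- real-number facts about the block
  have hur : (0 : ℝ) < u := by exact_mod_cast hu
  have hc2 : (0 : ℝ) < (u : ℝ) * G - v := by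
    have : (v : ℝ) < u * G := by exact_mod_cast hvu
    linarith
  have hΛr : (u : ℝ) * Q₂ < ((u : ℝ) * G - v) * Λ := by
    have h1 : ((u * Q₂ : ℕ) : ℝ) < ((Λ * (u * G - v) : ℕ) : ℝ) := by exact_mod_cast hΛQ
    rw [Nat.cast_mul, Nat.cast_mul, Nat.cast_sub hvu.le, Nat.cast_mul] at h1
    linarith
  generalize hDst : ((u : ℝ) * G - v) * Λ - u * Q₂ = Dst at *
  have hDst0 : 0 < Dst := by rw [← hDst]; linarith
  generalize hRst : (((v : ℝ) + u * G) * Λ + u * Q₂) / Dst = Rst at *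
  have hRst1 : 1 ≤ Rst := by
    rw [← hRst, le_div_iff₀ hDst0, ← hDst]
    have : (0 : ℝ) ≤ v := Nat.cast_nonneg _
    nlinarith [Nat.cast_nonneg (α := ℝ) Λ, Nat.cast_nonneg (α := ℝ) Q₂, hur.le]
  generalize hA : 4 / π + 2 / π * Real.log Rst + (u : ℝ) / Dst + (u : ℝ) ^ 2 / (π * Dst ^ 2) = A at *
  have hA0 : 0 ≤ A := by
    have h1 : 0 ≤ Real.log Rst := Real.log_nonneg hRst1
    rw [← hA]; positivity
  have hΛ'0 : 0 < Λ' := lt_of_lt_of_le hΛ0 hΛΛ'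
  -- the window and the plateau
  set p : ℤ → ℕ := fun n => v * n.natAbs / u + Q₂ with hp
  set W : Finset (Fin 2 → ℤ) := ((Finset.Icc (-((v * Λ' : ℕ) : ℤ)) (v * Λ' : ℕ) ×ˢ Finset.Icc (-(Λ' : ℤ)) Λ').filter
      (fun q : ℤ × ℤ => (X : ℤ) ≤ |q.1| ∧ (u : ℤ) * |q.1| ≤ v * |q.2| ∧ |q.2| ≤ Λ')).image
      (fun q : ℤ × ℤ => (fun i : Fin 2 => if i = 0 then q.1 else q.2)) with hWdef
  have hWall : ∀ k ∈ W, (X : ℤ) ≤ |k 0| ∧ (u : ℤ) * |k 0| ≤ v * |k 1| ∧ |k 1| ≤ Λ' := by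
    intro k hk
    obtain ⟨q, hq, rfl⟩ := Finset.mem_image.mp hk
    have h := (Finset.mem_filter.mp hq).2
    simpa using h
  have huz : (1 : ℤ) ≤ u := by exact_mod_cast hu
  have hqW : ∀ k : Fin 2 → ℤ, ((X : ℤ) ≤ |k 0| ∧ (u : ℤ) * |k 0| ≤ v * |k 1|) → |k 1| ≤ (Λ' : ℤ) → k ∈ W := by
    intro k hk h2
    have hk0 : |k 0| ≤ ((v * Λ' : ℕ) : ℤ) := by
      push_cast
      have h3 : (v : ℤ) * |k 1| ≤ v * Λ' := mul_le_mul_of_nonneg_left h2 (by positivity)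
      nlinarith [abs_nonneg (k 0)]
    refine Finset.mem_image.mpr ⟨(k 0, k 1), ?_, ?_⟩
    · refine Finset.mem_filter.mpr ⟨Finset.mem_product.mpr ⟨Finset.mem_Icc.mpr ?_, Finset.mem_Icc.mpr ?_⟩, hk.1, hk.2, h2⟩
      · exact ⟨by linarith [neg_abs_le (k 0)], by linarith [le_abs_self (k 0)]⟩
      · exact ⟨by linarith [neg_abs_le (k 1)], by linarith [le_abs_self (k 1)]⟩
    · funext i; fin_cases i <;> simp
  have hW : ∀ k ∈ W, (Λ : ℤ) ≤ |k 1| ∧ |k 1| ≤ Λ' := fun k hk => by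
    obtain ⟨h1, h2, h3⟩ := hWall k hk
    refine ⟨?_, h3⟩
    have hΛXz : (v : ℤ) * Λ ≤ u * X := by exact_mod_cast hΛX
    have hvz : (0 : ℤ) < v := by exact_mod_cast hv
    nlinarith
  have hnat : ∀ k ∈ W, Λ ≤ (k 1).natAbs ∧ (k 1).natAbs ≤ Λ' := fun k hk => by
    obtain ⟨h, h'⟩ := hW k hk
    rw [← Int.natCast_natAbs] at h h'
    exact ⟨by exact_mod_cast h, by exact_mod_cast h'⟩
  have hWp : ∀ k ∈ W, |k 0| + Q₂ ≤ (p (k 1) : ℤ) := fun k hk => by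
    obtain ⟨-, h2, -⟩ := hWall k hk
    simp only [hp, Nat.cast_add]
    have : |k 0| ≤ ((v * (k 1).natAbs / u : ℕ) : ℤ) := by
      rw [Int.natCast_div, Nat.cast_mul, Int.natCast_natAbs]
      exact Int.le_ediv_of_mul_le (by exact_mod_cast hu) (by linarith [mul_comm (u : ℤ) (|k 0|)])
    linarith
  have hpG : ∀ k ∈ W, p (k 1) < (k 1).natAbs * G := by
    intro k hk
    have h1 := (hnat k hk).1
    -- `u (⌊v n/u⌋ + Q₂) ≤ v n + u Q₂ < u n G` for `n ≥ Λ`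
    have key : u * p (k 1) < u * ((k 1).natAbs * G) := by
      have hdiv : u * (v * (k 1).natAbs / u) ≤ v * (k 1).natAbs := Nat.mul_div_le _ _
      have hmono : u * Q₂ + v * (k 1).natAbs < u * ((k 1).natAbs * G) := by
        have hΛQ' : u * Q₂ < (k 1).natAbs * (u * G - v) :=
          lt_of_lt_of_le hΛQ (Nat.mul_le_mul_right _ h1)
        have e : (k 1).natAbs * (u * G - v) + v * (k 1).natAbs = u * ((k 1).natAbs * G) := by
          zify [hvu.le]; ring
        omega
      simp only [hp, Nat.mul_add]
      omega
    exact Nat.lt_of_mul_lt_mul_left key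
  -- the kernel constants on the block: `u·p(n) ≤ v|n| + uQ₂`
  have hup : ∀ k ∈ W, (u : ℝ) * p (k 1) ≤ (v : ℝ) * ((k 1).natAbs : ℝ) + u * Q₂ := fun k hk => by
    have h : u * p (k 1) ≤ v * (k 1).natAbs + u * Q₂ := by
      have hdiv : u * (v * (k 1).natAbs / u) ≤ v * (k 1).natAbs := Nat.mul_div_le _ _
      simp only [hp, Nat.mul_add]
      exact Nat.add_le_add_right hdiv _
    exact_mod_cast h
  have hA' : ∀ k ∈ W, 4 / π + 2 / π * Real.log ((((p (k 1) : ℝ) + ((k 1).natAbs * G : ℕ)) /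
        ((((k 1).natAbs * G : ℕ) : ℝ) - p (k 1)))) + 1 / ((((k 1).natAbs * G : ℕ) : ℝ) - p (k 1)) +
        1 / (π * (((((k 1).natAbs * G : ℕ) : ℝ) - p (k 1))) ^ 2) ≤ A := by
    intro k hk
    have hx : (Λ : ℝ) ≤ ((k 1).natAbs : ℝ) := by exact_mod_cast (hnat k hk).1
    have hupk := hup k hk
    have hpG' : (p (k 1) : ℝ) < (((k 1).natAbs * G : ℕ) : ℝ) := by exact_mod_cast hpG k hk
    have hnG : (((k 1).natAbs * G : ℕ) : ℝ) = ((k 1).natAbs : ℝ) * G := by push_cast; rfl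
    rw [hnG] at hpG' ⊢
    -- the ratio is at most `R*`
    have hm : ((u : ℝ) * G - v) * Λ ≤ ((u : ℝ) * G - v) * ((k 1).natAbs : ℝ) := mul_le_mul_of_nonneg_left hx hc2.le
    have hD1 : 0 < ((u : ℝ) * G - v) * ((k 1).natAbs : ℝ) - u * Q₂ := by linarith only [hm, hΛr]
    have step1 : ((p (k 1) : ℝ) + ((k 1).natAbs : ℝ) * G) / (((k 1).natAbs : ℝ) * G - p (k 1)) ≤
        (((v : ℝ) + u * G) * ((k 1).natAbs : ℝ) + u * Q₂) / (((u : ℝ) * G - v) * ((k 1).natAbs : ℝ) - u * Q₂) := by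
      rw [div_le_div_iff₀ (sub_pos.mpr hpG') hD1]
      have hnG0 : 0 ≤ ((k 1).natAbs : ℝ) * G := by positivity
      have key : 0 ≤ ((k 1).natAbs : ℝ) * G * ((v : ℝ) * ((k 1).natAbs : ℝ) + u * Q₂ - u * p (k 1)) :=
        mul_nonneg hnG0 (by linarith only [hupk])
      have e : (((v : ℝ) + u * G) * ((k 1).natAbs : ℝ) + u * Q₂) * (((k 1).natAbs : ℝ) * G - p (k 1)) -
          ((p (k 1) : ℝ) + ((k 1).natAbs : ℝ) * G) * (((u : ℝ) * G - v) * ((k 1).natAbs : ℝ) - u * Q₂) =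
          2 * (((k 1).natAbs : ℝ) * G * ((v : ℝ) * ((k 1).natAbs : ℝ) + u * Q₂ - u * p (k 1))) := by ring
      linarith only [key, e]
    have hratio : ((p (k 1) : ℝ) + ((k 1).natAbs : ℝ) * G) / (((k 1).natAbs : ℝ) * G - p (k 1)) ≤ Rst := by
      refine step1.trans ?_
      rw [← hRst, ← hDst]
      exact ratioClass_ratio_le hx hΛr (by positivity) (by positivity) hc2
    have hp0 : (0 : ℝ) ≤ p (k 1) := Nat.cast_nonneg _
    have hRpos : 0 < ((p (k 1) : ℝ) + ((k 1).natAbs : ℝ) * G) / (((k 1).natAbs : ℝ) * G - p (k 1)) :=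
      div_pos (by linarith only [hp0, hpG']) (sub_pos.mpr hpG')
    have hlog : Real.log (((p (k 1) : ℝ) + ((k 1).natAbs : ℝ) * G) / (((k 1).natAbs : ℝ) * G - p (k 1))) ≤ Real.log Rst :=
      Real.log_le_log hRpos hratio
    -- the ramp is at least `D*/u`
    have e1 : ((u : ℝ) * G - v) * ((k 1).natAbs : ℝ) = u * (((k 1).natAbs : ℝ) * G) - v * ((k 1).natAbs : ℝ) := by ring
    have e2 : (((k 1).natAbs : ℝ) * G - p (k 1)) * u = u * (((k 1).natAbs : ℝ) * G) - u * p (k 1) := by ring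
    have hD : Dst / u ≤ ((k 1).natAbs : ℝ) * G - p (k 1) := by
      rw [div_le_iff₀ hur, ← hDst, e2]
      linarith only [hm, e1, hupk]
    have hDu : 0 < Dst / u := div_pos hDst0 hur
    have h2 : 1 / (((k 1).natAbs : ℝ) * G - p (k 1)) ≤ (u : ℝ) / Dst := by
      rw [show (u : ℝ) / Dst = 1 / (Dst / u) by field_simp]
      exact one_div_le_one_div_of_le hDu hD
    have h3 : 1 / (π * (((k 1).natAbs : ℝ) * G - p (k 1)) ^ 2) ≤ (u : ℝ) ^ 2 / (π * Dst ^ 2) := by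
      rw [show (u : ℝ) ^ 2 / (π * Dst ^ 2) = 1 / (π * (Dst / u) ^ 2) by field_simp]
      exact one_div_le_one_div_of_le (by positivity)
        (mul_le_mul_of_nonneg_left (pow_le_pow_left₀ hDu.le hD 2) Real.pi_pos.le)
    rw [← hA]
    have hπ : 0 < 2 / π := by positivity
    have h1 := mul_le_mul_of_nonneg_left hlog hπ.le
    linarith only [h1, h2, h3]
  have hτ' : ∀ k ∈ W, 1 / (2 * ((((k 1).natAbs * G : ℕ) : ℝ) - p (k 1))) ≤ (u : ℝ) / (2 * Dst) := by
    intro k hk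
    have hx : (Λ : ℝ) ≤ ((k 1).natAbs : ℝ) := by exact_mod_cast (hnat k hk).1
    have hupk := hup k hk
    have hnG : (((k 1).natAbs * G : ℕ) : ℝ) = ((k 1).natAbs : ℝ) * G := by push_cast; rfl
    rw [hnG]
    have hm : ((u : ℝ) * G - v) * Λ ≤ ((u : ℝ) * G - v) * ((k 1).natAbs : ℝ) := mul_le_mul_of_nonneg_left hx hc2.le
    have e1 : ((u : ℝ) * G - v) * ((k 1).natAbs : ℝ) = u * (((k 1).natAbs : ℝ) * G) - v * ((k 1).natAbs : ℝ) := by ring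
    have e2 : (((k 1).natAbs : ℝ) * G - p (k 1)) * u = u * (((k 1).natAbs : ℝ) * G) - u * p (k 1) := by ring
    have hD : Dst / u ≤ ((k 1).natAbs : ℝ) * G - p (k 1) := by
      rw [div_le_iff₀ hur, ← hDst, e2]
      linarith only [hm, e1, hupk]
    have hDu : 0 < Dst / u := div_pos hDst0 hur
    rw [show (u : ℝ) / (2 * Dst) = 1 / (2 * (Dst / u)) by field_simp]
    exact one_div_le_one_div_of_le (by positivity) (by linarith only [hD])
  exact tsum_class_vstep_le_log P hγ hδ₀ hd hN₀ hρN a b has h0 hb hab j hQ hΛ'0 p _ W hqW hW hWp hpG hd₀ hM hMδ hMd hA0 hA'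
    hτ' hAd hε0 hε

end Cascade

end Summit.AnomalousDissipation.AnomalousDissipation.Theorems.SawtoothPulseCascade.K1Window
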